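import Mathlib.Analysis.SpecialFunctions.Pow.Real
import Mathlib.Analysis.SpecialFunctions.Pow.NNReal
import Mathlib.Analysis.SpecificLimits.Normed
import Literature.Computability.AlgebraicComplexity.GroupTheoreticMatMul
import Literature.Combinatorics.Additive.TricoloredSumFreeBound
import Literature.Combinatorics.Additive.BorderTricoloredSumFree
import HarnessLib

/-!
# Proof of Blasiak–Church–Cohn–Grochow–Naslund–Sawin–Umans 2017, Theorem B

Topic: `Literature/Computability/AlgebraicComplexity`; second sibling proof file of
`GroupTheoreticMatMul.lean` (the first, `GroupTheoreticMatMulProofs.lean`, discharges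
`CohnKleinbergSzegedyUmans2005_5_5_abelian` via characters and the asymptotic sum inequality and
is import-disjoint from the slice-rank material used here), discharging the named fact
`Literature.Computability.AlgebraicComplexity.BlasiakChurchCohnGrochowNaslundSawinUmans2017_B` (BCCGNSU 2017, Thm. B: for every
`ℓ` there is `ε_ℓ > 0` such that no STPP construction in an abelian group of exponent at most `ℓ`
yields a bound better than `ω ≤ 2 + ε_ℓ` via `Σᵢ (|Aᵢ||Bᵢ||Cᵢ|)^{ω/3} ≤ |H|`; effective reading:
`Σᵢ (|Aᵢ||Bᵢ||Cᵢ|)^{(2+ε)/3} ≤ |H|`) as the sorry-free theorem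
`Literature.Computability.AlgebraicComplexity.BlasiakChurchCohnGrochowNaslundSawinUmans2017_B_holds`.

The proof is the paper's (§3.2, "Theorem A implies Theorem B"), made effective:

* STPP algebra (`AddSimultaneousTPP.rotate/prod/pi/comp`, CKSU 2005 §5 / proof of BCCGNSU
  Lemma 3.5) and the abelian packing bound `|Aᵢ||Bᵢ||Cᵢ| ≤ |H|` (Cohn–Umans 2003, Lemma 3.1);
* `AddSimultaneousTPP.card_mul_sq_le` — for a *uniform square* STPP family (`|Aᵢ|=|Bᵢ|=|Cᵢ|=m`)
  in a group `G` all of whose powers satisfy a tricolored sum-free bound `≤ C K^{N'}`: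
  `|ι| m² ≤ 3K` (Thm. 3.3 + Lemma 3.4 of `BorderTricoloredSumFree.lean` + `N' → ∞`,
  `le_of_pow_le_poly_mul_pow`);
* `AddSimultaneousTPP.exists_sum_rpow_le` — the key inequality `Σᵢ (|Aᵢ||Bᵢ||Cᵢ|)^{2/3} ≤
  |H|^{1-δ_ℓ}`: tensor power `N`, words grouped by type (`wordType`, the "distributions" of the
  proof of Lemma 3.5, at most `(N+1)^{|ι₀|}` of them), the symmetrised uniform square sub-family
  of `(A^u × B^v × C^w, B^u × C^v × A^w, C^u × A^v × B^w)` in `(H^N)^3` for each type, the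
  tricolored sum-free bound of `TricoloredSumFreeBound.lean` (Thm. A, weak form) in the powers of
  `(H^N)^3` (still of exponent `≤ ℓ`), and `N → ∞`;
* Thm. B with `ε = 3δ_ℓ`, using `mᵢ^{(2+ε)/3} ≤ mᵢ^{2/3} |H|^{δ}`.

(The paper phrases §3.2 by contradiction over families meeting the "packing bound" of Lemma 2.4;
the direct estimate on `Σ mᵢ^{2/3}` above is the same argument with the bookkeeping done on the
quantity of interest, and avoids Lemma 2.4.)

## References

* J. Blasiak, T. Church, H. Cohn, J. A. Grochow, E. Naslund, W. F. Sawin, C. Umans, *On cap sets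
  and the group-theoretic approach to matrix multiplication*, Discrete Analysis 2017:3,
  arXiv:1605.06702: Thm. A, Thm. B and (1.1) (p. 3), Def. 2.2, Lemma 2.4 (p. 5), Thm. 3.3
  (p. 7), Lemma 3.4, Lemma 3.5 (p. 8), §3.2 (p. 9), Thm. A proved in §4.4 (pp. 16–17). (Page
  numbers of the held 19-page PDF, `lit read arxiv:1605.06702 --pages …`.)
* H. Cohn, C. Umans, *A group-theoretic approach to fast matrix multiplication*, FOCS 2003,
  arXiv:math/0307321, Lemma 3.1 (abelian groups: `|S||T||U| ≤ |G|`).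
-/

noncomputable section

namespace Literature.Computability.AlgebraicComplexity.Combinatorics

open Finset

/-! ### Operations on STPP families (CKSU 2005, §5; BCCGNSU 2017, proof of Lemma 3.5) -/

section Operations

variable {H : Type*} [AddCommGroup H] {ι : Type*}

/-- Cyclic rotation `(A, B, C) ↦ (B, C, A)` preserves the STPP. [folklore] -/
theorem _root_.Literature.Combinatorics.Additive.AddSimultaneousTPP.rotate {A B C : ι → Finset H} (h : Literature.Combinatorics.Additive.AddSimultaneousTPP A B C) :
    Literature.Combinatorics.Additive.AddSimultaneousTPP B C A := by
  rw [Literature.Combinatorics.Additive.addSimultaneousTPP_iff_forall] at h ⊢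
  intro i j k s hs s' hs' t ht t' ht' u hu u' hu' h0
  have h0' : (u' - u) + (s' - s) + (t' - t) = 0 := by rw [← h0]; abel
  obtain ⟨hki, hij, huu, hss, htt⟩ := h k i j u hu u' hu' s hs s' hs' t ht t' ht' h0'
  exact ⟨hij, hij.symm.trans hki.symm, hss, htt, huu⟩

/-- Products of STPP families (in `H₁ × H₂`, indexed by `ι₁ × ι₂`) are STPP families (CKSU 2005,
proof of Lemma 5.4 / BCCGNSU 2017, proof of Lemma 3.5: "It is not hard to verify that these sets
satisfy the STPP in `H^{3N}`").
[cite: BlasiakChurchCohnGrochowNaslundSawinUmans2017, Lemma 3.5 (proof)] -/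
theorem _root_.Literature.Combinatorics.Additive.AddSimultaneousTPP.prod {H₂ : Type*} [AddCommGroup H₂] {ι₂ : Type*}
    {A B C : ι → Finset H} {A₂ B₂ C₂ : ι₂ → Finset H₂} (h : Literature.Combinatorics.Additive.AddSimultaneousTPP A B C)
    (h₂ : Literature.Combinatorics.Additive.AddSimultaneousTPP A₂ B₂ C₂) :
    Literature.Combinatorics.Additive.AddSimultaneousTPP (fun p : ι × ι₂ => A p.1 ×ˢ A₂ p.2) (fun p => B p.1 ×ˢ B₂ p.2)
      (fun p => C p.1 ×ˢ C₂ p.2) := by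
  rw [Literature.Combinatorics.Additive.addSimultaneousTPP_iff_forall] at h h₂ ⊢
  rintro ⟨i, i₂⟩ ⟨j, j₂⟩ ⟨k, k₂⟩ s hs s' hs' t ht t' ht' u hu u' hu' h0
  simp only [Finset.mem_product] at hs hs' ht ht' hu hu'
  rw [Prod.ext_iff] at h0
  simp only [Prod.fst_add, Prod.fst_sub, Prod.snd_add, Prod.snd_sub, Prod.fst_zero,
    Prod.snd_zero] at h0
  obtain ⟨hij, hjk, hss, htt, huu⟩ := h i j k _ hs.1 _ hs'.1 _ ht.1 _ ht'.1 _ hu.1 _ hu'.1 h0.1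
  obtain ⟨hij₂, hjk₂, hss₂, htt₂, huu₂⟩ :=
    h₂ i₂ j₂ k₂ _ hs.2 _ hs'.2 _ ht.2 _ ht'.2 _ hu.2 _ hu'.2 h0.2
  exact ⟨Prod.ext hij hij₂, Prod.ext hjk hjk₂, Prod.ext hss hss₂, Prod.ext htt htt₂,
    Prod.ext huu huu₂⟩

/-- Powers of an STPP family (in `H^κ`, indexed by `ι^κ`, the sets being boxes) are STPP
families (CKSU 2005, Lemma 5.4; BCCGNSU 2017, proof of Lemma 3.5).
[cite: BlasiakChurchCohnGrochowNaslundSawinUmans2017, Lemma 3.5 (proof)] -/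
theorem _root_.Literature.Combinatorics.Additive.AddSimultaneousTPP.pi {κ : Type*} [Fintype κ] [DecidableEq κ]
    {A B C : ι → Finset H} (h : Literature.Combinatorics.Additive.AddSimultaneousTPP A B C) :
    Literature.Combinatorics.Additive.AddSimultaneousTPP (G := κ → H)
      (fun I : κ → ι => Fintype.piFinset fun l => A (I l))
      (fun I => Fintype.piFinset fun l => B (I l))
      (fun I => Fintype.piFinset fun l => C (I l)) := by
  rw [Literature.Combinatorics.Additive.addSimultaneousTPP_iff_forall] at h ⊢
  intro I J K s hs s' hs' t ht t' ht' u hu u' hu' h0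
  simp only [Fintype.mem_piFinset] at hs hs' ht ht' hu hu'
  have hl : ∀ l, I l = J l ∧ J l = K l ∧ s l = s' l ∧ t l = t' l ∧ u l = u' l :=
    fun l => h (I l) (J l) (K l) _ (hs l) _ (hs' l) _ (ht l) _ (ht' l) _ (hu l) _ (hu' l)
      (by simpa using congr_fun h0 l)
  exact ⟨funext fun l => (hl l).1, funext fun l => (hl l).2.1, funext fun l => (hl l).2.2.1,
    funext fun l => (hl l).2.2.2.1, funext fun l => (hl l).2.2.2.2⟩

/-- Sub-families (reindexing along an injection) of STPP families are STPP families. [folklore] -/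
theorem _root_.Literature.Combinatorics.Additive.AddSimultaneousTPP.comp {ι' : Type*} {A B C : ι → Finset H} (h : Literature.Combinatorics.Additive.AddSimultaneousTPP A B C)
    {e : ι' → ι} (he : Function.Injective e) :
    Literature.Combinatorics.Additive.AddSimultaneousTPP (A ∘ e) (B ∘ e) (C ∘ e) := by
  rw [Literature.Combinatorics.Additive.addSimultaneousTPP_iff_forall] at h ⊢
  intro i j k s hs s' hs' t ht t' ht' u hu u' hu' h0
  obtain ⟨hij, hjk, rest⟩ := h (e i) (e j) (e k) s hs s' hs' t ht t' ht' u hu u' hu' h0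
  exact ⟨he hij, he hjk, rest⟩

/-- Each triple of an STPP family in an abelian group satisfies `|Aᵢ||Bᵢ||Cᵢ| ≤ |H|`: by the
triple product property the map `(a,b,c) ↦ a + b + c` is injective on `Aᵢ × Bᵢ × Cᵢ`
(Cohn–Umans 2003, Lemma 3.1; cf. `Literature.Computability.AlgebraicComplexity.RealizesTPP.mul_mul_le_card`).
[cite: CohnUmans2003, Lemma 3.1] -/
theorem _root_.Literature.Combinatorics.Additive.AddSimultaneousTPP.card_mul_card_mul_card_le [Fintype H] {A B C : ι → Finset H}
    (h : Literature.Combinatorics.Additive.AddSimultaneousTPP A B C) (i : ι) :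
    (A i).card * (B i).card * (C i).card ≤ Fintype.card H := by
  classical
  rw [Literature.Combinatorics.Additive.addSimultaneousTPP_iff_forall] at h
  have hinj : Set.InjOn (fun x : H × H × H => x.1 + x.2.1 + x.2.2) ↑((A i) ×ˢ (B i) ×ˢ (C i)) := by
    rintro ⟨a, b, c⟩ hx ⟨a', b', c'⟩ hx' (he : a + b + c = a' + b' + c')
    simp only [Finset.coe_product, Set.mem_prod, Finset.mem_coe] at hx hx'
    have h0 : (a - a') + (b - b') + (c - c') = 0 := by
      have : (a - a') + (b - b') + (c - c') = (a + b + c) - (a' + b' + c') := by abel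
      rw [this, he, sub_self]
    obtain ⟨-, -, h1, h2, h3⟩ := h i i i a' hx'.1 a hx.1 b' hx'.2.1 b hx.2.1 c' hx'.2.2 c hx.2.2 h0
    simp [h1, h2, h3]
  calc (A i).card * (B i).card * (C i).card = ((A i) ×ˢ (B i) ×ˢ (C i)).card := by
        rw [Finset.card_product, Finset.card_product, mul_assoc]
    _ = (((A i) ×ˢ (B i) ×ˢ (C i)).image fun x : H × H × H => x.1 + x.2.1 + x.2.2).card :=
        (Finset.card_image_of_injOn hinj).symm
    _ ≤ Fintype.card H := Finset.card_le_univ _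

end Operations

/-! ### A growth lemma -/

/-- If `x^N ≤ c (N+1)^d y^N` for all `N ≥ 1` then `x ≤ y` (polynomial factors are negligible
against exponential growth; the "tensor power trick"). [folklore] -/
theorem le_of_pow_le_poly_mul_pow {x y c : ℝ} {d : ℕ} (hy : 0 < y)
    (h : ∀ N : ℕ, 1 ≤ N → x ^ N ≤ c * ((N : ℝ) + 1) ^ d * y ^ N) : x ≤ y := by
  by_contra hxy
  push Not at hxy
  have hx : 0 ≤ x := hy.le.trans hxy.le
  set ρ := x / y with hρ
  have hρ1 : 1 < ρ := (one_lt_div hy).2 hxy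
  have hc : 0 ≤ c := by
    have h1 := h 1 le_rfl
    have : 0 < ((1 : ℕ) : ℝ) + 1 := by norm_num
    by_contra hc
    push Not at hc
    have : c * (((1 : ℕ) : ℝ) + 1) ^ d * y ^ 1 < 0 :=
      mul_neg_of_neg_of_pos (mul_neg_of_neg_of_pos hc (by positivity)) (by positivity)
    linarith [pow_nonneg hx 1]
  -- `ρ^N ≤ c 2^d N^d` for `N ≥ 1`
  have hρN : ∀ N : ℕ, 1 ≤ N → ρ ^ N ≤ c * 2 ^ d * (N : ℝ) ^ d := by
    intro N hN
    have h1 := h N hN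
    rw [hρ, div_pow, div_le_iff₀ (pow_pos hy N)]
    refine h1.trans ?_
    have h2 : ((N : ℝ) + 1) ^ d ≤ 2 ^ d * (N : ℝ) ^ d := by
      rw [← mul_pow]
      exact pow_le_pow_left₀ (by positivity) (by norm_cast; omega) d
    calc c * ((N : ℝ) + 1) ^ d * y ^ N ≤ c * (2 ^ d * (N : ℝ) ^ d) * y ^ N := by gcongr
      _ = c * 2 ^ d * (N : ℝ) ^ d * y ^ N := by ring
  have ht := tendsto_pow_const_div_const_pow_of_one_lt d hρ1
  have hε : (0 : ℝ) < 1 / (c * 2 ^ d + 1) := by positivity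
  have hev := (ht.eventually (gt_mem_nhds hε)).and (Filter.eventually_ge_atTop 1)
  obtain ⟨N, hN1, hN2⟩ := hev.exists
  have hρpos : 0 < ρ ^ N := pow_pos (by linarith) N
  have hNpos : (0 : ℝ) < N := by exact_mod_cast hN2
  have hNd : (0 : ℝ) < (N : ℝ) ^ d := pow_pos hNpos d
  set Kc := c * 2 ^ d with hKc
  set P := (N : ℝ) ^ d with hP
  have hk : 0 < Kc + 1 := by positivity
  rw [div_lt_iff₀ hρpos, one_div, inv_mul_eq_div, lt_div_iff₀ hk] at hN1
  have h4 := hρN N hN2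
  have h5 : P * (Kc + 1) = Kc * P + P := by ring
  rw [h5] at hN1
  linarith

/-! ### Uniform STPP families: the key estimate (BCCGNSU 2017, §3.2) -/

section Uniform

/-- **The §3.2 estimate, effective form.** Let `G` be a finite abelian group such that every
tricolored sum-free set in `G^{N'}` has size at most `C · K^{N'}` (all `N'`). If an STPP family
in `G` indexed by `ι` is *uniform and square*, `|Aᵢ| = |Bᵢ| = |Cᵢ| = m` for all `i`, then
`|ι| m² ≤ 3K`. Proof as in BCCGNSU 2017, §3.2: Thm. 3.3 gives a border tricolored sum-free set
of size `≥ Σᵢ m³/(3m) = |ι| m²/3`, Lemma 3.4 converts its `N'`-th power into a tricolored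
sum-free set in `G^{N'}` of size `≥ (|ι|m²/3)^{N'}/(2N't+1)²`, and `N' → ∞` gives the claim.
[cite: BlasiakChurchCohnGrochowNaslundSawinUmans2017, §3.2] -/
theorem _root_.Literature.Combinatorics.Additive.AddSimultaneousTPP.card_mul_sq_le {G : Type} [AddCommGroup G] [DecidableEq G]
    {C K : ℝ} (hK : 0 < K)
    (hTSF : ∀ (N' : ℕ) (ι' : Type) [Fintype ι'] (s t u : ι' → (Fin N' → G)),
      Literature.Combinatorics.Additive.IsTricoloredSumFree s t u → (Fintype.card ι' : ℝ) ≤ C * K ^ N')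
    {ι : Type} [Fintype ι] {A B C' : ι → Finset G} (hS : Literature.Combinatorics.Additive.AddSimultaneousTPP A B C') {m : ℕ}
    (hA : ∀ i, (A i).card = m) (hB : ∀ i, (B i).card = m) (hC' : ∀ i, (C' i).card = m) :
    (Fintype.card ι : ℝ) * (m : ℝ) ^ 2 ≤ 3 * K := by
  classical
  rcases Nat.eq_zero_or_pos m with hm | hm
  · subst hm; simp; positivity
  obtain ⟨M, α, β, γ, hBd, hsize⟩ := hS.exists_isBorderTricoloredSumFree
  -- size of the border set: `|ι| m²/3 ≤ |M|`
  have hMsize : (Fintype.card ι : ℝ) * (m : ℝ) ^ 2 / 3 ≤ M.card := by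
    refine le_trans (le_of_eq ?_) hsize
    simp only [hA, hB, hC']
    rw [Finset.sum_const, card_univ, nsmul_eq_mul]
    have hm0 : (m : ℝ) ≠ 0 := by exact_mod_cast hm.ne'
    field_simp
    ring
  -- range of the weights
  set R : ℕ := Finset.univ.sup fun x : M => max (α x.1).natAbs (β x.1).natAbs with hR
  have hRb : ∀ x : M, |α x.1| ≤ R ∧ |β x.1| ≤ R := by
    intro x
    have hx : max (α x.1).natAbs (β x.1).natAbs ≤ R := Finset.le_sup (f := fun x : M =>
      max (α x.1).natAbs (β x.1).natAbs) (mem_univ x)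
    rw [Int.abs_eq_natAbs, Int.abs_eq_natAbs]
    constructor <;> [exact_mod_cast (le_max_left _ _).trans hx;
      exact_mod_cast (le_max_right _ _).trans hx]
  -- powers
  have hpow : ∀ N' : ℕ, 1 ≤ N' →
      ((M.card : ℕ) : ℝ) ^ N' ≤ C * (2 * R + 1) ^ 2 * ((N' : ℝ) + 1) ^ 2 * K ^ N' := by
    intro N' hN'
    obtain ⟨M', hT, hcard⟩ := hBd.exists_isTricoloredSumFree_pi R hRb N'
    have h1 := hTSF N' M' _ _ _ hT
    rw [Fintype.card_coe] at h1
    have h2 : ((Fintype.card M : ℕ) : ℝ) ^ N' ≤ ((2 * N' * R + 1) ^ 2 : ℕ) * (M'.card : ℝ) := by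
      exact_mod_cast hcard
    rw [Fintype.card_coe] at h2
    have h3 : (((2 * N' * R + 1) ^ 2 : ℕ) : ℝ) ≤ (2 * R + 1) ^ 2 * ((N' : ℝ) + 1) ^ 2 := by
      rw [← mul_pow]
      push_cast
      apply pow_le_pow_left₀ (by positivity)
      nlinarith [show (0 : ℝ) ≤ R from by positivity, show (1 : ℝ) ≤ N' from by exact_mod_cast hN']
    calc ((M.card : ℕ) : ℝ) ^ N' ≤ ((2 * N' * R + 1) ^ 2 : ℕ) * (M'.card : ℝ) := h2
      _ ≤ ((2 * R + 1) ^ 2 * ((N' : ℝ) + 1) ^ 2) * (C * K ^ N') := by gcongr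
      _ = C * (2 * R + 1) ^ 2 * ((N' : ℝ) + 1) ^ 2 * K ^ N' := by ring
  have hMK : (M.card : ℝ) ≤ K :=
    le_of_pow_le_poly_mul_pow (c := C * (2 * R + 1) ^ 2) (d := 2) hK fun N' hN' => by
      have := hpow N' hN'
      linarith
  linarith

end Uniform

/-! ### The tensor-power/type argument and Theorem B -/

section TheoremB

/-- Powers of products of powers of `H` have exponent at most that of `H`. [folklore] -/
theorem exponent_pi_prod_pi_le {H : Type*} [AddCommGroup H] [Finite H] (N N' : ℕ) :
    AddMonoid.exponent (Fin N' → (Fin N → H) × (Fin N → H) × (Fin N → H)) ≤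
      AddMonoid.exponent H := by
  refine AddMonoid.exponent_min' _ (AddMonoid.exponent_pos.2 AddMonoid.ExponentExists.of_finite)
    fun g => ?_
  ext l <;> simp [AddMonoid.exponent_nsmul_eq_zero]

/-- The *type* (distribution) of a word `u ∈ ι₀^N`: `i ↦ #{l : u_l = i} ∈ {0,…,N}` ("the
distribution of `u` is the vector specifying the number of times each element of `[n]` occurs in
`u`", BCCGNSU 2017, proof of Lemma 3.5).
[cite: BlasiakChurchCohnGrochowNaslundSawinUmans2017, Lemma 3.5 (proof)] -/
def wordType {ι₀ : Type*} [DecidableEq ι₀] {N : ℕ} (u : Fin N → ι₀) (i : ι₀) : Fin (N + 1) :=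
  ⟨(univ.filter fun l => u l = i).card,
    Nat.lt_succ_of_le ((Finset.card_filter_le _ _).trans (by simp))⟩

/-- `∏ₗ f(u_l) = ∏ᵢ f(i)^{type(u)ᵢ}`: products over a word only depend on its type.
[cite: BlasiakChurchCohnGrochowNaslundSawinUmans2017, Lemma 3.5 (proof)] -/
theorem prod_eq_prod_pow_wordType {ι₀ : Type*} [Fintype ι₀] [DecidableEq ι₀] {N : ℕ}
    (f : ι₀ → ℕ) (u : Fin N → ι₀) : ∏ l, f (u l) = ∏ i, f i ^ ((wordType u i) : ℕ) := by
  rw [← Finset.prod_fiberwise_of_maps_to (g := u) (t := univ) (fun l _ => mem_univ _)]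
  refine Finset.prod_congr rfl fun i _ => ?_
  rw [Finset.prod_congr rfl fun l hl => (show f (u l) = f i by rw [(mem_filter.1 hl).2]),
    Finset.prod_const]
  rfl

/-- The tricolored sum-free bound of Thm. A in the powers of `G = (H^N)^3`, rewritten with
`|G^{N'}|^{1-δ} = ((|H|^{1-δ})^{3N})^{N'}`.
[cite: BlasiakChurchCohnGrochowNaslundSawinUmans2017, §3.2] -/
theorem card_le_of_isTricoloredSumFree_pi_prod {H : Type} [AddCommGroup H] [Fintype H] {ℓ : ℕ}
    {δ : ℝ}
    (hA : ∀ (G : Type) [AddCommGroup G] [Fintype G], AddMonoid.exponent G ≤ ℓ →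
      ∀ (ι : Type) [Fintype ι] (s t u : ι → G), Literature.Combinatorics.Additive.IsTricoloredSumFree s t u →
        (Fintype.card ι : ℝ) ≤ 3 * (Fintype.card G : ℝ) ^ (1 - δ))
    (hexp : AddMonoid.exponent H ≤ ℓ) (N N' : ℕ) (ι' : Type) [Fintype ι']
    (s t u : ι' → (Fin N' → (Fin N → H) × (Fin N → H) × (Fin N → H)))
    (hT : Literature.Combinatorics.Additive.IsTricoloredSumFree s t u) :
    (Fintype.card ι' : ℝ) ≤ 3 * (((Fintype.card H : ℝ) ^ (1 - δ)) ^ (3 * N)) ^ N' := by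
  classical
  have hHpos : (0 : ℝ) < Fintype.card H := by exact_mod_cast Fintype.card_pos
  have h := hA (Fin N' → (Fin N → H) × (Fin N → H) × (Fin N → H))
    ((exponent_pi_prod_pi_le N N').trans hexp) ι' s t u hT
  have hcardG : (Fintype.card (Fin N' → (Fin N → H) × (Fin N → H) × (Fin N → H)) : ℝ) =
      (Fintype.card H : ℝ) ^ (3 * N * N') := by
    rw [Fintype.card_fun, Fintype.card_prod, Fintype.card_prod, Fintype.card_fun,
      Fintype.card_fin, Fintype.card_fin]
    push_cast
    ring
  rw [hcardG] at h
  refine h.trans (le_of_eq ?_)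
  rw [← pow_mul, ← Real.rpow_mul_natCast hHpos.le, ← Real.rpow_natCast_mul hHpos.le]
  congr 2
  push_cast
  ring

/-- **Per-type estimate** (BCCGNSU 2017, Lemma 3.5 + §3.2, effective): for the product STPP
family `(A^u × B^v × C^w, B^u × C^v × A^w, C^u × A^v × B^w)` in `(H^N)^3` restricted to words
`u, v, w` of a fixed type `τ` (a uniform square STPP family with `T_τ³` triples of size
`m_τ = ∏ᵢ (|Aᵢ||Bᵢ||Cᵢ|)^{τᵢ}`), `AddSimultaneousTPP.card_mul_sq_le` gives `T_τ³ m_τ² ≤ 3K`.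
[cite: BlasiakChurchCohnGrochowNaslundSawinUmans2017, Lemma 3.5] -/
theorem _root_.Literature.Combinatorics.Additive.AddSimultaneousTPP.card_fiber_pow_three_mul_sq_le {H : Type} [AddCommGroup H]
    [DecidableEq H] {ι₀ : Type} [Fintype ι₀] [DecidableEq ι₀] {A B C : ι₀ → Finset H}
    (hS : Literature.Combinatorics.Additive.AddSimultaneousTPP A B C) (N : ℕ) {K : ℝ} (hK : 0 < K)
    (hTSF : ∀ (N' : ℕ) (ι' : Type) [Fintype ι']
      (s t u : ι' → (Fin N' → (Fin N → H) × (Fin N → H) × (Fin N → H))),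
      Literature.Combinatorics.Additive.IsTricoloredSumFree s t u → (Fintype.card ι' : ℝ) ≤ 3 * K ^ N')
    (τ : ι₀ → Fin (N + 1)) :
    (((univ : Finset (Fin N → ι₀)).filter fun u => wordType u = τ).card : ℝ) ^ 3 *
      (((∏ i, ((A i).card * (B i).card * (C i).card) ^ (τ i : ℕ) : ℕ) : ℝ)) ^ 2 ≤ 3 * K := by
  classical
  set Tf : Finset (Fin N → ι₀) := univ.filter fun u => wordType u = τ with hTf
  have hTfmem : ∀ u : Tf, wordType u.1 = τ := fun u => (mem_filter.1 u.2).2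
  set piA : (Fin N → ι₀) → Finset (Fin N → H) := fun u => Fintype.piFinset fun l => A (u l)
    with hpiA
  set piB : (Fin N → ι₀) → Finset (Fin N → H) := fun u => Fintype.piFinset fun l => B (u l)
    with hpiB
  set piC : (Fin N → ι₀) → Finset (Fin N → H) := fun u => Fintype.piFinset fun l => C (u l)
    with hpiC
  have hSpi : Literature.Combinatorics.Additive.AddSimultaneousTPP (G := Fin N → H) piA piB piC := hS.pi
  have hbig := hSpi.prod (hSpi.rotate.prod hSpi.rotate.rotate)
  set emb : Tf × Tf × Tf → (Fin N → ι₀) × (Fin N → ι₀) × (Fin N → ι₀) :=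
    fun x => (x.1.1, x.2.1.1, x.2.2.1) with hemb
  have hinj : Function.Injective emb := by
    rintro ⟨u, v, w⟩ ⟨u', v', w'⟩ h
    simp only [hemb, Prod.mk.injEq] at h
    exact Prod.ext (Subtype.ext h.1) (Prod.ext (Subtype.ext h.2.1) (Subtype.ext h.2.2))
  have hSτ := hbig.comp hinj
  have hsA : ∀ u : Tf, (piA u.1).card = ∏ i, (A i).card ^ (τ i : ℕ) := by
    intro u; rw [hpiA]; simp only
    rw [Fintype.card_piFinset, prod_eq_prod_pow_wordType (fun i => (A i).card) u.1, hTfmem u]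
  have hsB : ∀ u : Tf, (piB u.1).card = ∏ i, (B i).card ^ (τ i : ℕ) := by
    intro u; rw [hpiB]; simp only
    rw [Fintype.card_piFinset, prod_eq_prod_pow_wordType (fun i => (B i).card) u.1, hTfmem u]
  have hsC : ∀ u : Tf, (piC u.1).card = ∏ i, (C i).card ^ (τ i : ℕ) := by
    intro u; rw [hpiC]; simp only
    rw [Fintype.card_piFinset, prod_eq_prod_pow_wordType (fun i => (C i).card) u.1, hTfmem u]
  set mτ : ℕ := (∏ i, (A i).card ^ (τ i : ℕ)) * (∏ i, (B i).card ^ (τ i : ℕ)) *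
    (∏ i, (C i).card ^ (τ i : ℕ)) with hmτ
  have hmτ' : mτ = ∏ i, ((A i).card * (B i).card * (C i).card) ^ (τ i : ℕ) := by
    rw [hmτ, ← Finset.prod_mul_distrib, ← Finset.prod_mul_distrib]
    refine Finset.prod_congr rfl fun i _ => ?_
    rw [mul_pow, mul_pow]
  have hU := Literature.Combinatorics.Additive.AddSimultaneousTPP.card_mul_sq_le (C := 3) hK hTSF hSτ (m := mτ)
    (fun x => by
      show (piA x.1.1 ×ˢ (piB x.2.1.1 ×ˢ piC x.2.2.1)).card = mτ
      rw [Finset.card_product, Finset.card_product, hsA, hsB, hsC, hmτ, mul_assoc])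
    (fun x => by
      show (piB x.1.1 ×ˢ (piC x.2.1.1 ×ˢ piA x.2.2.1)).card = mτ
      rw [Finset.card_product, Finset.card_product, hsA, hsB, hsC, hmτ]; ring)
    (fun x => by
      show (piC x.1.1 ×ˢ (piA x.2.1.1 ×ˢ piB x.2.2.1)).card = mτ
      rw [Finset.card_product, Finset.card_product, hsA, hsB, hsC, hmτ]; ring)
  rw [Fintype.card_prod, Fintype.card_prod, Fintype.card_coe, hmτ'] at hU
  push_cast at hU
  refine le_trans (le_of_eq ?_) hU
  push_cast
  ring

/-- **The key inequality behind Thm. B** (BCCGNSU 2017, §3.2 made effective): for every `ℓ`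
there is `δ > 0` such that every STPP family `(Aᵢ, Bᵢ, Cᵢ)_{i ∈ ι₀}` in a finite abelian group
`H` of exponent at most `ℓ` satisfies `Σᵢ (|Aᵢ||Bᵢ||Cᵢ|)^{2/3} ≤ |H|^{1-δ}`. Proof: with
`F = Σᵢ mᵢ^{2/3}`, expand `F^N = Σ_{u ∈ ι₀^N} ∏ₗ m_{u_l}^{2/3}` and group the words `u` by their
type (at most `(N+1)^{|ι₀|}` types); for a fixed type `τ` the sub-family of the product STPP
family `(A^u × B^v × C^w, B^u × C^v × A^w, C^u × A^v × B^w)` in `(H^N)^3` (BCCGNSU Lemma 3.5)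
with `u, v, w` of type `τ` is uniform and square, so `AddSimultaneousTPP.card_mul_sq_le` and the
tricolored sum-free bound `exists_tricoloredSumFree_card_le` (Thm. A) in the powers of `(H^N)^3`
give `T_τ · m_τ^{2/3} ≤ 3^{1/3} |H|^{N(1-δ)}`; hence `F^N ≤ (N+1)^{|ι₀|} 3^{1/3} |H|^{N(1-δ)}`
for all `N`, and `N → ∞`. [cite: BlasiakChurchCohnGrochowNaslundSawinUmans2017, §3.2] -/
theorem _root_.Literature.Combinatorics.Additive.AddSimultaneousTPP.exists_sum_rpow_le (ℓ : ℕ) : ∃ δ : ℝ, 0 < δ ∧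
    ∀ (H : Type) [AddCommGroup H] [Fintype H] [DecidableEq H], AddMonoid.exponent H ≤ ℓ →
      ∀ (ι₀ : Type) [Fintype ι₀] [DecidableEq ι₀] (A B C : ι₀ → Finset H),
        Literature.Combinatorics.Additive.AddSimultaneousTPP A B C →
          ∑ i, (((A i).card * (B i).card * (C i).card : ℕ) : ℝ) ^ ((2 : ℝ) / 3) ≤
            (Fintype.card H : ℝ) ^ (1 - δ) := by
  obtain ⟨δ, hδ, hA⟩ := Literature.Combinatorics.Additive.exists_tricoloredSumFree_card_le.{0, 0} ℓ
  refine ⟨δ, hδ, fun H _ _ _ hexp ι₀ _ _ A B C hS => ?_⟩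
  set m : ι₀ → ℕ := fun i => (A i).card * (B i).card * (C i).card with hm
  set Y : ℝ := (Fintype.card H : ℝ) ^ (1 - δ) with hY
  have hHpos : (0 : ℝ) < Fintype.card H := by exact_mod_cast Fintype.card_pos
  have hYpos : 0 < Y := Real.rpow_pos_of_pos hHpos _
  set F : ℝ := ∑ i, ((m i : ℕ) : ℝ) ^ ((2 : ℝ) / 3) with hF
  suffices hclaim : ∀ N : ℕ, 1 ≤ N →
      F ^ N ≤ (3 : ℝ) ^ ((1 : ℝ) / 3) * ((N : ℝ) + 1) ^ Fintype.card ι₀ * Y ^ N from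
    le_of_pow_le_poly_mul_pow hYpos hclaim
  intro N hN
  set K : ℝ := Y ^ (3 * N) with hK
  have hKpos : 0 < K := pow_pos hYpos _
  have hTSF : ∀ (N' : ℕ) (ι' : Type) [Fintype ι']
      (s t u : ι' → (Fin N' → (Fin N → H) × (Fin N → H) × (Fin N → H))),
      Literature.Combinatorics.Additive.IsTricoloredSumFree s t u → (Fintype.card ι' : ℝ) ≤ 3 * K ^ N' :=
    fun N' ι' _ s t u hT => card_le_of_isTricoloredSumFree_pi_prod hA hexp N N' ι' s t u hT
  have htype_bound := fun τ => hS.card_fiber_pow_three_mul_sq_le N hKpos hTSF τ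
  -- expand `F^N` over words
  have hFN : F ^ N =
      ∑ u : Fin N → ι₀, (((∏ i, m i ^ (wordType u i : ℕ) : ℕ) : ℝ)) ^ ((2 : ℝ) / 3) := by
    have h1 : F ^ N = ∏ _l : Fin N, F := by rw [Finset.prod_const, card_univ, Fintype.card_fin]
    rw [h1, hF, Fintype.prod_sum (fun (_ : Fin N) (i : ι₀) => ((m i : ℕ) : ℝ) ^ ((2 : ℝ) / 3))]
    refine Finset.sum_congr rfl fun u _ => ?_
    rw [Real.finsetProd_rpow _ _ (fun l _ => by positivity), ← prod_eq_prod_pow_wordType m u]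
    push_cast
    rfl
  rw [hFN, ← Finset.sum_fiberwise_of_maps_to (g := wordType) (t := univ) (fun u _ => mem_univ _)]
  have h3 : (0 : ℝ) ≤ (3 : ℝ) ^ ((1 : ℝ) / 3) * Y ^ N :=
    mul_nonneg (Real.rpow_nonneg (by norm_num) _) (pow_nonneg hYpos.le _)
  have hτ : ∀ τ : ι₀ → Fin (N + 1),
      ∑ u ∈ univ.filter (fun u => wordType u = τ),
        (((∏ i, m i ^ (wordType u i : ℕ) : ℕ) : ℝ)) ^ ((2 : ℝ) / 3) ≤
          3 ^ ((1 : ℝ) / 3) * Y ^ N := by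
    intro τ
    rw [Finset.sum_congr rfl fun u hu => (show (((∏ i, m i ^ (wordType u i : ℕ) : ℕ) : ℝ)) ^
      ((2 : ℝ) / 3) = (((∏ i, m i ^ (τ i : ℕ) : ℕ) : ℝ)) ^ ((2 : ℝ) / 3) by
        rw [(mem_filter.1 hu).2]), Finset.sum_const, nsmul_eq_mul]
    set T : ℝ := (((univ : Finset (Fin N → ι₀)).filter fun u => wordType u = τ).card : ℝ) with hT
    set P : ℝ := ((∏ i, m i ^ (τ i : ℕ) : ℕ) : ℝ) with hP
    have hP0 : 0 ≤ P := Nat.cast_nonneg _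
    have hb : T ^ 3 * P ^ 2 ≤ 3 * K := htype_bound τ
    refine le_of_pow_le_pow_left₀ three_ne_zero h3 ?_
    calc (T * P ^ ((2 : ℝ) / 3)) ^ 3 = T ^ 3 * P ^ 2 := by
          rw [mul_pow, ← Real.rpow_natCast (P ^ ((2 : ℝ) / 3)) 3, ← Real.rpow_mul hP0]
          norm_num
      _ ≤ 3 * K := hb
      _ = ((3 : ℝ) ^ ((1 : ℝ) / 3) * Y ^ N) ^ 3 := by
          rw [mul_pow, ← Real.rpow_natCast ((3 : ℝ) ^ ((1 : ℝ) / 3)) 3,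
            ← Real.rpow_mul (by norm_num : (0 : ℝ) ≤ 3), hK, ← pow_mul, mul_comm N 3]
          norm_num
  calc ∑ τ : ι₀ → Fin (N + 1), ∑ u ∈ univ.filter (fun u => wordType u = τ),
        (((∏ i, m i ^ (wordType u i : ℕ) : ℕ) : ℝ)) ^ ((2 : ℝ) / 3)
      ≤ ∑ _τ : ι₀ → Fin (N + 1), (3 : ℝ) ^ ((1 : ℝ) / 3) * Y ^ N :=
        Finset.sum_le_sum fun τ _ => hτ τ
    _ = (3 : ℝ) ^ ((1 : ℝ) / 3) * ((N : ℝ) + 1) ^ Fintype.card ι₀ * Y ^ N := by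
        rw [Finset.sum_const, card_univ, nsmul_eq_mul, Fintype.card_fun, Fintype.card_fin]
        push_cast
        ring

end TheoremB

end Literature.Computability.AlgebraicComplexity.Combinatorics

/-! ### Theorem B -/

namespace Literature.Computability.AlgebraicComplexity

open Finset

/-- `IsSTPP` (the route predicate, `Fin N`-indexed) is the tree's `AddSimultaneousTPP`
(`addSimultaneousTPP_iff_forall` followed by `Iff.rfl`). [folklore] -/
theorem isSTPP_iff_addSimultaneousTPP {H : Type*} [AddCommGroup H] {N : ℕ}
    (A B C : Fin N → Finset H) :
    IsSTPP A B C ↔ Literature.Combinatorics.Additive.AddSimultaneousTPP A B C :=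
  (Literature.Combinatorics.Additive.addSimultaneousTPP_iff_forall A B C).symm

/-- **Blasiak–Church–Cohn–Grochow–Naslund–Sawin–Umans 2017, Thm. B**, PROVED: for every `ℓ`
there is `ε > 0` (namely `ε = 3δ` with the `δ` of
`Literature.Combinatorics.Additive.AddSimultaneousTPP.exists_sum_rpow_le`) such that every STPP construction in a
finite abelian group `H` of exponent at most `ℓ` satisfies
`Σᵢ (|Aᵢ||Bᵢ||Cᵢ|)^{(2+ε)/3} ≤ |H|`, i.e. cannot yield a bound better than `ω ≤ 2 + ε` via
(1.1). Proof: `(|Aᵢ||Bᵢ||Cᵢ|)^{(2+ε)/3} ≤ (|Aᵢ||Bᵢ||Cᵢ|)^{2/3} |H|^{δ}` since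
`|Aᵢ||Bᵢ||Cᵢ| ≤ |H|` (triple product property in an abelian group), and
`Σᵢ (|Aᵢ||Bᵢ||Cᵢ|)^{2/3} ≤ |H|^{1-δ}`.
[cite: BlasiakChurchCohnGrochowNaslundSawinUmans2017, Thm. B] -/
theorem BlasiakChurchCohnGrochowNaslundSawinUmans2017_B_holds :
    BlasiakChurchCohnGrochowNaslundSawinUmans2017_B := by
  intro ℓ
  obtain ⟨δ, hδ, hmain⟩ := Literature.Combinatorics.Additive.AddSimultaneousTPP.exists_sum_rpow_le ℓ
  refine ⟨3 * δ, by positivity, ?_⟩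
  intro H _ _ hexp N A B C hS
  classical
  have hS' := (isSTPP_iff_addSimultaneousTPP A B C).1 hS
  have h := hmain H hexp (Fin N) A B C hS'
  have hHpos : (0 : ℝ) < Fintype.card H := by exact_mod_cast Fintype.card_pos
  have hexp_eq : (2 + 3 * δ) / 3 = (2 : ℝ) / 3 + δ := by ring
  rw [hexp_eq]
  calc ∑ i, (((A i).card * (B i).card * (C i).card : ℕ) : ℝ) ^ ((2 : ℝ) / 3 + δ)
      = ∑ i, (((A i).card * (B i).card * (C i).card : ℕ) : ℝ) ^ ((2 : ℝ) / 3) *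
          (((A i).card * (B i).card * (C i).card : ℕ) : ℝ) ^ δ := by
        refine Finset.sum_congr rfl fun i _ => ?_
        exact Real.rpow_add' (by positivity) (by positivity)
    _ ≤ ∑ i, (((A i).card * (B i).card * (C i).card : ℕ) : ℝ) ^ ((2 : ℝ) / 3) *
          (Fintype.card H : ℝ) ^ δ := by
        refine Finset.sum_le_sum fun i _ => ?_
        refine mul_le_mul_of_nonneg_left ?_ (by positivity)
        refine Real.rpow_le_rpow (by positivity) ?_ hδ.le
        exact_mod_cast hS'.card_mul_card_mul_card_le i
    _ = (Fintype.card H : ℝ) ^ δ *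
          ∑ i, (((A i).card * (B i).card * (C i).card : ℕ) : ℝ) ^ ((2 : ℝ) / 3) := by
        rw [← Finset.sum_mul, mul_comm]
    _ ≤ (Fintype.card H : ℝ) ^ δ * (Fintype.card H : ℝ) ^ (1 - δ) := by gcongr
    _ = Fintype.card H := by
        rw [← Real.rpow_add hHpos]
        norm_num

end Literature.Computability.AlgebraicComplexity

end
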